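import Literature.NumberTheory.Automorphic.QuaternionAlgebraAdelic
import HarnessLib

/-!
# Units of `D` inside `R ⊗[K] D`: discharge of `isUnit_scalarExtension_iff`

Sibling proof file of `Literature.NumberTheory.Automorphic.QuaternionAlgebraAdelic` (namespace
`Literature.Automorphic`), fully proved (no `sorry`), for the unit-group facts of Vignéras, LNM 800,
Ch. I §1 about the diagonal embedding `D ↪ D_R = R ⊗_K D` (`ScalarExtension.incl`).

* `ScalarExtension.incl_injective` : for a non-trivial commutative `K`-algebra `R` the map
  `D → R ⊗[K] D`, `d ↦ 1 ⊗ d`, is injective (Mathlib `Algebra.TensorProduct.includeRight_injective`: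
  every module over the field `K` is flat and `K → R` is injective). This is "L'algèbre H se
  plonge naturellement dans H_F" (Vignéras I §1, *Produits tensoriels*), for any `R ≠ 0` in place
  of an extension field `F`.
* `ScalarExtension.isUnit_incl_iff` : for a *finite-dimensional* `K`-algebra `D` and `R ≠ 0`,
  `1 ⊗ x` is a unit of `R ⊗[K] D` iff `x` is a unit of `D`. Proof (linear algebra): `x` is a
  unit iff left multiplication `y ↦ x y` is bijective, iff it is injective (`dim_K D < ∞`; Mathlib
  `Algebra.lmul_isUnit_iff`, `LinearMap.isUnit_iff_ker_eq_bot`); and if `1 ⊗ x` is a unit and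
  `x d = 0` then `(1 ⊗ x)(1 ⊗ d) = 0` forces `1 ⊗ d = 0`, so `d = 0` by injectivity of `incl`.
  The converse is functoriality of units under the ring map `incl`.
* `isUnit_scalarExtension_iff_holds` : **discharge** of the named fact
  `isUnit_scalarExtension_iff` (the case of a quaternion algebra `D`, `dim_K D = 4`, via the
  instance `IsQuaternionAlgebra.finite`). Source: Vignéras I §1, Lemme 1.1 ("Les éléments
  inversibles de H sont les éléments de norme réduite non nulle", with `N_{H/K} = n²` in the
  paragraph before it, proof "laissée en exercice") together with *Produits tensoriels*
  (`H_F = F ⊗_K H` is a quaternion algebra over `F ⊇ K` and `H ↪ H_F`): a unit of `H_F` coming from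
  `H` has non-zero reduced norm in `F`, hence in `K`, hence is a unit of `H`. The vendored fact
  allows any non-trivial commutative `R` (not only a field `F`), and the proof given here is the
  norm-free linear-algebra argument above, which needs only `dim_K D < ∞` and `R ≠ 0`; the
  hypotheses `CharZero K` and `IsQuaternionAlgebra K D` of the fact are used only through
  `Module.Finite K D`.

## References

* M.-F. Vignéras, *Arithmétique des algèbres de quaternions*, Lecture Notes in Math. 800,
  Springer (1980), doi:10.1007/BFb0091027, Ch. I §1 (pp. 1–5): Lemme 1.1 and the paragraph
  *Produits tensoriels*.
-/

noncomputable section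

open scoped TensorProduct

namespace Literature.NumberTheory.Automorphic

/-! ### The diagonal embedding `D ↪ R ⊗[K] D` and units -/

namespace ScalarExtension

variable (K : Type*) [Field K] (R : Type*) [CommRing R] [Algebra K R] (D : Type*) [Ring D]
  [Algebra K D]

/-- For a non-trivial commutative `K`-algebra `R` (`K` a field) the diagonal map
`incl : D → R ⊗[K] D`, `d ↦ 1 ⊗ d`, is injective (Vignéras I §1, *Produits tensoriels*: "L'algèbre
H se plonge naturellement dans H_F"; here for any `R ≠ 0`, by flatness of `D` over the field `K`
and injectivity of `K → R`, Mathlib `Algebra.TensorProduct.includeRight_injective`).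
[cite: VignerasLNM800, Ch. I §1 "Produits tensoriels" (pp. 1–5)] -/
theorem incl_injective [Nontrivial R] : Function.Injective (incl K R D) :=
  Algebra.TensorProduct.includeRight_injective (algebraMap K R).injective

/-- For a finite-dimensional algebra `D` over a field `K` and a non-trivial commutative `K`-algebra
`R`, an element `x ∈ D` is a unit of `R ⊗[K] D` (embedded by `incl`, `x ↦ 1 ⊗ x`) iff it is a unit
of `D`: `x` is a unit iff `y ↦ x y` is injective on `D` (finite dimension), and a unit `1 ⊗ x`
cannot kill a non-zero `1 ⊗ d` because `incl` is injective (`incl_injective`). For quaternion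
algebras this is Vignéras I §1, Lemme 1.1 with *Produits tensoriels* (units are detected by the
reduced norm, which is compatible with `H ↪ H_F`). [cite: VignerasLNM800, Ch. I §1 Lemme 1.1 and "Produits tensoriels" (pp. 1–5)] -/
theorem isUnit_incl_iff [Module.Finite K D] [Nontrivial R] (x : D) :
    IsUnit (incl K R D x) ↔ IsUnit x := by
  refine ⟨fun hx ↦ ?_, fun hx ↦ hx.map (incl K R D)⟩
  rw [← Algebra.lmul_isUnit_iff (R := K), LinearMap.isUnit_iff_ker_eq_bot, LinearMap.ker_eq_bot']
  intro d hd
  have hd : x * d = 0 := hd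
  apply incl_injective K R D
  rw [map_zero, ← hx.mul_right_inj, mul_zero, ← map_mul, hd, map_zero]

end ScalarExtension

/-! ### Discharge of `isUnit_scalarExtension_iff` -/

section IsUnitScalarExtensionHolds

universe u

variable (K : Type) [Field K] (D : Type u) [Ring D] [Algebra K D]

/-- **Discharge** of `isUnit_scalarExtension_iff`: for a quaternion algebra `D` over `K` and a
non-trivial commutative `K`-algebra `R`, an element `x ∈ D` is a unit of `R ⊗[K] D` (embedded by
`ScalarExtension.incl`) iff it is a unit of `D` — the case `dim_K D = 4` (instance
`IsQuaternionAlgebra.finite`) of `ScalarExtension.isUnit_incl_iff`. Vignéras, LNM 800, Ch. I §1: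
Lemme 1.1 (the units of `H` are the elements of non-zero reduced norm; proof left as an exercise
there) and *Produits tensoriels* (`H ↪ H_F = F ⊗_K H`); the book has a field `F ⊇ K`, the fact any
`R ≠ 0`, and the hypothesis `CharZero K` of the fact is not needed by this proof.
[cite: VignerasLNM800, Ch. I §1 Lemme 1.1 and "Produits tensoriels" (pp. 1–5)] -/
theorem isUnit_scalarExtension_iff_holds : isUnit_scalarExtension_iff K D := by
  intro _ _ R _ _ _ x
  exact ScalarExtension.isUnit_incl_iff K R D x

end IsUnitScalarExtensionHolds

end Literature.NumberTheory.Automorphic
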